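import Literature.AnabelianGeometry.AbsoluteAnabelian.AbsTopICharacterRankDirectSum
import Literature.AnabelianGeometry.AbsoluteAnabelian.AbsTopICharacterRankCyclotomicModel
import Literature.AnabelianGeometry.AbsoluteAnabelian.AbsTopICharacterRankSplitModel
import HarnessLib

/-!
# [AbsTopI] Lemma 4.5 (iii) at the hyperbolic-curve shape `V(ψ) ⊕ K(χ^{cyclo}) ⊕ V'(χ^{cyclo})`

Proof-only companion of `AbsTopICharacterRank.lean` (S. Mochizuki, *Topics in Absolute Anabelian
Geometry I: Generalities* [MochizukiAbsTopI2012], Lemma 4.5 (iii), kurims manuscript p. 54; [CombGC] =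
[MochizukiCombGC2007] Prop. 2.4 / Cor. 2.7 (i) pp. 19–23), cell abc-iut, block F, seat abc-iut-f-062
(FACT-LIST schemata F-0222 `Lem45iii_cuspCount`, F-0223 `Lem45iii_cycloClass`, F-0224 `Lem45iii_det`,
F-0225 `RealisedWeight`).  Sequel of `AbsTopICharacterRankDirectSum.lean` (the direct-sum calculus).

For a hyperbolic curve of genus `g ≥ 1` with `r ≥ 1` cusps the input module of Lemma 4.5 (iii) has the
shape `H^{ab} ⊗ ℚ_l ≅ V_l(J) ⊕ ℚ_l(1)^{⊕(r−1)}` (abelian-variety part of weight `1`, cuspidal part of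
weight `2`; [CombGC] Prop. 2.4).  ALGEBRAIC MODEL of that shape (consistency evidence only, not a
curve): the direct sum of the split model `M = V(ψ) ⊕ K(χ^{cyclo})` with `ψ² = χ^{cyclo}`
(`AbsTopICharacterRankSplitModel.lean`; `r = 2`) and the pure-cyclotomic model `V'(χ^{cyclo})`,
`dim V' = d > 0` (`AbsTopICharacterRankCyclotomicModel.lean`; `d + 1` cusps) — any `ρ` on
`(V × K) × V'` acting componentwise (hypothesis `hρ`; inhabited by `exists_prodRep`).  Everything is
READ OFF THE SUMMANDS by the direct-sum rules: realised weights `{0,1,2} ∪ {0,2} = {0,1,2}`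
(`realisedWeight_curveShape_iff`), A7 / A3 / A9 (`realisedWeightsSymmetric_curveShape`,
`detSqQuasiCyclotomic_curveShape`, `cuspCountViaWeights_curveShape` with `r = 2 + (d+1) − 1 = d + 2`),
and the three typed sentences of (iii) (`lem45iii_det_curveShape`, `lem45iii_cycloClass_curveShape`,
`lem45iii_cuspCount_curveShape … (d + 2)`).  Closed instance `Int42x3Model.lem45iii_all`: `G = ℤ`,
`K = ℚ`, `χ^{cyclo} = 4ⁿ`, `ψ = 2ⁿ`, `V = ℚ²`, `V' = ℚ³` — the shape of a genus-one curve with `5`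
cusps; realised weights exactly `{0,1,2}`, `5` cusps counted.
No new definitions.  HONEST FRAMING: refereed pre-IUT anabelian geometry (linear algebra of
`G`-modules); algebraic models are consistency evidence for the schemata, not instances of curves;
nothing here bears on [IUTchIII] Cor. 3.12.
-/

noncomputable section

open scoped Classical

namespace Literature.AnabelianGeometry.AbsoluteAnabelian.AbsTopI

universe u v w w'

section CurveShape

variable {G : Type u} [Group G] [TopologicalSpace G]
variable {K : Type v} [Field K]
variable {V : Type w} [AddCommGroup V] [Module K V]
variable {V' : Type w'} [AddCommGroup V'] [Module K V']
variable {χcyclo ψ : G →* Kˣ} {ρM : G →* ((V × K) ≃ₗ[K] (V × K))}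
  {ρ : G →* (((V × K) × V') ≃ₗ[K] ((V × K) × V'))}

/-- **Realised weights of the curve shape are exactly `{0, 1, 2}`** (`= {0,1,2} ∪ {0,2}`).
[cite: MochizukiAbsTopI2012, Lemma 4.5 (iii) p.54] [cite: MochizukiCombGC2007, Prop. 2.4 (vii) p.20] -/
theorem realisedWeight_curveShape_iff [FiniteDimensional K V] [FiniteDimensional K V']
    (hM : ρM = twist (withTrivial (twist (1 : G →* (V ≃ₗ[K] V)) (ψ * χcyclo⁻¹))) χcyclo)
    (hρ : ∀ (g : G) (x : (V × K) × V'),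
      ρ g x = (ρM g x.1, twist (1 : G →* (V' ≃ₗ[K] V')) χcyclo g x.2))
    (hψ : ∀ g : G, ψ g ^ 2 = χcyclo g)
    (hcyc : ∀ U : Subgroup G, IsOpen (U : Set G) → U.FiniteIndex →
      ∀ a : ℤ, a ≠ 0 → ∃ g ∈ U, χcyclo g ^ a ≠ 1)
    (hd : 0 < Module.finrank K V) (hd' : 0 < Module.finrank K V') (w : ℚ) :
    RealisedWeight χcyclo ρ w ↔ w = 0 ∨ w = 1 ∨ w = 2 := by
  rw [realisedWeight_prod_iff χcyclo hρ, realisedWeight_splitModel_iff hM hψ hcyc hd,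
    realisedWeight_cycloModel_iff χcyclo hcyc hd']
  tauto

/-- **A7 at the curve shape** ([CombGC] Prop. 2.4 (vii)), from A7 at the two summands.
[cite: MochizukiCombGC2007, Prop. 2.4 (vii) p.20] [cite: MochizukiAbsTopI2012, Lemma 4.5 (iii) p.54] -/
theorem realisedWeightsSymmetric_curveShape [FiniteDimensional K V] [FiniteDimensional K V']
    (hM : ρM = twist (withTrivial (twist (1 : G →* (V ≃ₗ[K] V)) (ψ * χcyclo⁻¹))) χcyclo)
    (hρ : ∀ (g : G) (x : (V × K) × V'),
      ρ g x = (ρM g x.1, twist (1 : G →* (V' ≃ₗ[K] V')) χcyclo g x.2))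
    (hψ : ∀ g : G, ψ g ^ 2 = χcyclo g)
    (hcyc : ∀ U : Subgroup G, IsOpen (U : Set G) → U.FiniteIndex →
      ∀ a : ℤ, a ≠ 0 → ∃ g ∈ U, χcyclo g ^ a ≠ 1)
    (hd : 0 < Module.finrank K V) (hd' : 0 < Module.finrank K V') :
    RealisedWeightsSymmetric χcyclo ρ :=
  realisedWeightsSymmetric_prod hρ (realisedWeightsSymmetric_splitModel hM hψ hcyc hd)
    (realisedWeightsSymmetric_cycloModel χcyclo hcyc hd')

/-- **A3 at the curve shape** ([CombGC] Prop. 2.4 (iii)): `det² = (χ^{cyclo})^{(dim V + 2) + 2·dim V'}`.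
[cite: MochizukiCombGC2007, Prop. 2.4 (iii) p.19] [cite: MochizukiAbsTopI2012, Lemma 4.5 (iii) p.54] -/
theorem detSqQuasiCyclotomic_curveShape [FiniteDimensional K V] [FiniteDimensional K V']
    (hM : ρM = twist (withTrivial (twist (1 : G →* (V ≃ₗ[K] V)) (ψ * χcyclo⁻¹))) χcyclo)
    (hρ : ∀ (g : G) (x : (V × K) × V'),
      ρ g x = (ρM g x.1, twist (1 : G →* (V' ≃ₗ[K] V')) χcyclo g x.2))
    (hψ : ∀ g : G, ψ g ^ 2 = χcyclo g) (hd' : 0 < Module.finrank K V') :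
    DetSqQuasiCyclotomic χcyclo ρ :=
  detSqQuasiCyclotomic_prod hρ (detSqQuasiCyclotomic_splitModel hM hψ)
    (detSqQuasiCyclotomic_cycloModel χcyclo hd')

/-- **A9 at the curve shape** ([CombGC] Cor. 2.7 (i) weight count): `r = 2 + (d + 1) − 1 = d + 2`
cusps, `d = dim V'`. [cite: MochizukiCombGC2007, Cor. 2.7 (i) proof p.23] [cite: MochizukiAbsTopI2012, Lemma 4.5 (iii) p.54] -/
theorem cuspCountViaWeights_curveShape [FiniteDimensional K V] [FiniteDimensional K V']
    (hM : ρM = twist (withTrivial (twist (1 : G →* (V ≃ₗ[K] V)) (ψ * χcyclo⁻¹))) χcyclo)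
    (hρ : ∀ (g : G) (x : (V × K) × V'),
      ρ g x = (ρM g x.1, twist (1 : G →* (V' ≃ₗ[K] V')) χcyclo g x.2))
    (hψ : ∀ g : G, ψ g ^ 2 = χcyclo g)
    (hcyc : ∀ U : Subgroup G, IsOpen (U : Set G) → U.FiniteIndex →
      ∀ a : ℤ, a ≠ 0 → ∃ g ∈ U, χcyclo g ^ a ≠ 1) :
    CuspCountViaWeights χcyclo ρ (Module.finrank K V' + 2) := by
  rw [cuspCountViaWeights_prod_iff hρ (cuspCountViaWeights_splitModel hM hψ hcyc)
    (cuspCountViaWeights_cycloModel χcyclo hcyc)]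
  push_cast
  ring

/-- **F-0224 at the curve shape**: the determinant character is `ℚ`-cyclotomic of positive weight.
[cite: MochizukiAbsTopI2012, Lemma 4.5 (iii) p.54] -/
theorem lem45iii_det_curveShape [FiniteDimensional K V] [FiniteDimensional K V']
    (hM : ρM = twist (withTrivial (twist (1 : G →* (V ≃ₗ[K] V)) (ψ * χcyclo⁻¹))) χcyclo)
    (hρ : ∀ (g : G) (x : (V × K) × V'),
      ρ g x = (ρM g x.1, twist (1 : G →* (V' ≃ₗ[K] V')) χcyclo g x.2))
    (hψ : ∀ g : G, ψ g ^ 2 = χcyclo g) (hd' : 0 < Module.finrank K V') : Lem45iii_det χcyclo ρ :=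
  lem45iii_det_prod hρ (lem45iii_det_splitModel hM hψ) (lem45iii_det_cycloModel χcyclo hd')

/-- **F-0223 at the curve shape**: the max/min-weight characterisation of the class of `χ^{cyclo}`
holds (max `2`, min `0`, three realised weights). [cite: MochizukiAbsTopI2012, Lemma 4.5 (iii) p.54]
[cite: MochizukiCombGC2007, Prop. 2.4 (vii) p.20] -/
theorem lem45iii_cycloClass_curveShape [FiniteDimensional K V] [FiniteDimensional K V']
    (hM : ρM = twist (withTrivial (twist (1 : G →* (V ≃ₗ[K] V)) (ψ * χcyclo⁻¹))) χcyclo)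
    (hρ : ∀ (g : G) (x : (V × K) × V'),
      ρ g x = (ρM g x.1, twist (1 : G →* (V' ≃ₗ[K] V')) χcyclo g x.2))
    (hψ : ∀ g : G, ψ g ^ 2 = χcyclo g)
    (hcyc : ∀ U : Subgroup G, IsOpen (U : Set G) → U.FiniteIndex →
      ∀ a : ℤ, a ≠ 0 → ∃ g ∈ U, χcyclo g ^ a ≠ 1)
    (hd : 0 < Module.finrank K V) (hd' : 0 < Module.finrank K V') : Lem45iii_cycloClass χcyclo ρ :=
  lem45iii_cycloClass_of_realisedWeightsSymmetric χcyclo ρ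
    (realisedWeightsSymmetric_curveShape hM hρ hψ hcyc hd hd')

/-- **F-0222 at the curve shape**: "`d_χ + 1` copies of `Spec(k̃)`" with `d_χ + 1 = dim V' + 2`
cusps (A9 ∧ A10 ⇒ A11). [cite: MochizukiAbsTopI2012, Lemma 4.5 (iii) p.54] [cite: MochizukiCombGC2007, Cor. 2.7 (i) proof p.23] -/
theorem lem45iii_cuspCount_curveShape [FiniteDimensional K V] [FiniteDimensional K V']
    (hM : ρM = twist (withTrivial (twist (1 : G →* (V ≃ₗ[K] V)) (ψ * χcyclo⁻¹))) χcyclo)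
    (hρ : ∀ (g : G) (x : (V × K) × V'),
      ρ g x = (ρM g x.1, twist (1 : G →* (V' ≃ₗ[K] V')) χcyclo g x.2))
    (hψ : ∀ g : G, ψ g ^ 2 = χcyclo g)
    (hcyc : ∀ U : Subgroup G, IsOpen (U : Set G) → U.FiniteIndex →
      ∀ a : ℤ, a ≠ 0 → ∃ g ∈ U, χcyclo g ^ a ≠ 1) :
    Lem45iii_cuspCount χcyclo ρ (Module.finrank K V' + 2) :=
  cuspCountOfWeights_holds χcyclo _ _ (cuspCountViaWeights_curveShape hM hρ hψ hcyc)
    (dualRankEq_holds _)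

end CurveShape

/-! ### A closed instance: `G = ℤ`, `K = ℚ`, `χ^{cyclo} = 4ⁿ`, `ψ = 2ⁿ`, `V = ℚ²`, `V' = ℚ³` (`r = 5`) -/

namespace Int42x3Model

/-- **[AbsTopI] Lemma 4.5 (iii) at a CLOSED curve-shape model** (`G = ℤ` written multiplicatively,
`K = ℚ`, `χ^{cyclo}(n) = 4ⁿ`, `ψ(n) = 2ⁿ`, module `(ℚ²(ψ) ⊕ ℚ(χ^{cyclo})) ⊕ ℚ³(χ^{cyclo})` — the shape
of `V_l(E) ⊕ ℚ_l(1)^{⊕ 4}` for an elliptic curve with `5` punctures): SOME componentwise `ρ` exists,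
and for it A3, A7 (realised weights exactly `{0, 1, 2}`), A9 with `5` cusps and `Lem45iii_det`,
`Lem45iii_cycloClass`, `Lem45iii_cuspCount … 5` all hold.  Consistency evidence; not a curve.
[cite: MochizukiAbsTopI2012, Lemma 4.5 (iii) p.54] [cite: MochizukiCombGC2007, Cor. 2.7 (i) proof p.23] -/
theorem lem45iii_all :
    ∃ ρ : Multiplicative ℤ →*
        ((((Fin 2 → ℚ) × ℚ) × (Fin 3 → ℚ)) ≃ₗ[ℚ] (((Fin 2 → ℚ) × ℚ) × (Fin 3 → ℚ))),
      DetSqQuasiCyclotomic (zpowersHom ℚˣ (Units.mk0 (4 : ℚ) (by positivity))) ρ ∧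
      RealisedWeightsSymmetric (zpowersHom ℚˣ (Units.mk0 (4 : ℚ) (by positivity))) ρ ∧
      (∀ w : ℚ, RealisedWeight (zpowersHom ℚˣ (Units.mk0 (4 : ℚ) (by positivity))) ρ w ↔
        w = 0 ∨ w = 1 ∨ w = 2) ∧
      CuspCountViaWeights (zpowersHom ℚˣ (Units.mk0 (4 : ℚ) (by positivity))) ρ 5 ∧
      Lem45iii_det (zpowersHom ℚˣ (Units.mk0 (4 : ℚ) (by positivity))) ρ ∧
      Lem45iii_cycloClass (zpowersHom ℚˣ (Units.mk0 (4 : ℚ) (by positivity))) ρ ∧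
      Lem45iii_cuspCount (zpowersHom ℚˣ (Units.mk0 (4 : ℚ) (by positivity))) ρ 5 := by
  obtain ⟨ρ, hρ⟩ := exists_prodRep
    (twist (withTrivial (twist (1 : Multiplicative ℤ →* ((Fin 2 → ℚ) ≃ₗ[ℚ] (Fin 2 → ℚ)))
      (zpowersHom ℚˣ (Units.mk0 (2 : ℚ) (by positivity)) *
        (zpowersHom ℚˣ (Units.mk0 (4 : ℚ) (by positivity)))⁻¹)))
      (zpowersHom ℚˣ (Units.mk0 (4 : ℚ) (by positivity))))
    (twist (1 : Multiplicative ℤ →* ((Fin 3 → ℚ) ≃ₗ[ℚ] (Fin 3 → ℚ)))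
      (zpowersHom ℚˣ (Units.mk0 (4 : ℚ) (by positivity))))
  have hd : 0 < Module.finrank ℚ (Fin 2 → ℚ) := by simp
  have hd' : 0 < Module.finrank ℚ (Fin 3 → ℚ) := by simp
  have h5 : Module.finrank ℚ (Fin 3 → ℚ) + 2 = 5 := by simp
  have hcyc := nondegenerate_zpowersHom (x := (4 : ℚ)) (by norm_num)
  refine ⟨ρ, detSqQuasiCyclotomic_curveShape rfl hρ Int42Model.psi_sq hd',
    realisedWeightsSymmetric_curveShape rfl hρ Int42Model.psi_sq hcyc hd hd',
    realisedWeight_curveShape_iff rfl hρ Int42Model.psi_sq hcyc hd hd', ?_,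
    lem45iii_det_curveShape rfl hρ Int42Model.psi_sq hd',
    lem45iii_cycloClass_curveShape rfl hρ Int42Model.psi_sq hcyc hd hd', ?_⟩
  · have := cuspCountViaWeights_curveShape rfl hρ Int42Model.psi_sq hcyc
    rwa [h5] at this
  · have := lem45iii_cuspCount_curveShape rfl hρ Int42Model.psi_sq hcyc
    rwa [h5] at this

end Int42x3Model

end Literature.AnabelianGeometry.AbsoluteAnabelian.AbsTopI

end
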